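import Literature.MathematicalPhysics.QuantumManyBody.PeriodicHeatFlowSpectral
import Literature.MathematicalPhysics.QuantumManyBody.PeriodicConfigFourier
import Literature.MathematicalPhysics.QuantumManyBody.PeriodicFeynmanKacFreeForm
import Literature.MathematicalPhysics.QuantumManyBody.GroundStateFeynmanKacGaussian
import HarnessLib

/-!
# Crux `CorrectorClosure` (stmt-AtomisticToContinuum-12058), line `healing-scale-kac-insertion` —
# Fourier multipliers for the registered stub `stub_uvTransfer` (part 1 of 2)

Supports (does not close) stmt-AtomisticToContinuum-12058, route `BECInsertionCorrector`.
The UV-transfer stub bounds from below the mass kept by the Gaussian smoothing of the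
`(N+1)`-body torus Feynman–Kac ground state in the tagged coordinate. Its proof diagonalises the
two Gaussian translation averages involved — the tagged smoothing `e^{TΔ₀}` and the free torus
flow `e^{tΔ} = periodicHeatFlow 0` — in the plane waves `e_n(X) = e^{2πi n·X/L}` of the cell
`[0,L)^{3N}` (`PeriodicConfigFourier.lean`), for merely measurable periodic data:

* the Gaussian characteristic functions (`charFun_gaussianReal` read against the density,
  transported to a block `ℝ³ = EuclideanSpace ℝ (Fin 3)` and, by Fubini, to `(ℝ³)^N`);
* Parseval on the cell for `L²` data (`hasSum_sq_configFourierCoeff_of_memLp`; the tree has the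
  continuous case), with Mathlib's Haar probability measure on `ℝ/ℤ` (the local instance of
  `Analysis.Fourier.AddCircleMulti`) as a TERM-local instance — no instance is declared;
* the multiplier rule `ĉₙ(X ↦ ∫ Ψ(X + φ(ω)) dμ(ω)) = (∫ e_n(φ(ω)) dμ(ω)) ĉₙ(Ψ)` for a finite
  measure `μ` and periodic `Ψ ∈ L¹(cell)` (`configFourierCoeff_integral_translate`: Fubini and the
  translation rule `configFourierCoeff_translate`);
* the free torus flow `periodicHeatFlow 0 N L t` is the Gaussian average `E[ψ(X + √2 b_t)]`, with
  multiplier `e^{-4π²t|n|²/L²}` (`configFourierCoeff_periodicHeatFlow_zero_pot`, through the law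
  `N(0, 2t I_{3N})` of the displacement, `map_displacement_eq`);
* the tagged-particle smoothing `X ↦ ∫ Ψ(X - z e₀) dγ_{2T}(z)` has multiplier `e^{-4π²T|n₀|²/L²}`,
  `n₀` the tagged block of the frequency (`configFourierCoeff_gaussian_single_zero`, the registered
  sub-goal of this helper file).

(Bose symmetry of the coefficients, `configFourierCoeff_perm`, is already in the tree:
`BECInsertionCorrectorStaticResponseBoundTruncationMonotone.lean`.)

References: Mathlib `Analysis.Fourier.AddCircleMulti` (`hasSum_sq_mFourierCoeff`),
`Probability.Distributions.Gaussian.Real` (`charFun_gaussianReal`); Chung–Zhao (1995) §3.2 (the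
free semigroup of the flat torus as a Gaussian average of translates).
-/

noncomputable section

open MeasureTheory ProbabilityTheory Filter Matrix Complex UnitAddTorus
open scoped ENNReal NNReal BigOperators ComplexConjugate

namespace Summit.AtomisticToContinuum.BoseEinsteinCondensation.Theorems.CorrectorClosure.HealingScaleKacInsertion

open Literature.MathematicalPhysics.QuantumManyBody.BoseGas
open Literature.Probability.Process (preWienerMeasure brownian measurable_brownian)

variable {N : ℕ} {L : ℝ}

/-! ### Gaussian characteristic functions -/

/-- **Characteristic function of the centred Gaussian, density form**: for `v ≠ 0`,
`∫ gaussianPDFReal 0 v x · e^{iξx} dx = e^{-vξ²/2}` (Mathlib's `charFun_gaussianReal` read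
against the density). [folklore] -/
theorem integral_gaussianPDFReal_smul_cexp {v : ℝ≥0} (hv : v ≠ 0) (ξ : ℝ) :
    ∫ x : ℝ, gaussianPDFReal 0 v x • cexp (↑ξ * ↑x * I) = cexp (-(↑(v : ℝ) * ↑ξ ^ 2 / 2)) := by
  have h := charFun_gaussianReal (μ := 0) (v := v) ξ
  rw [charFun_apply_real, integral_gaussianReal_eq_integral_smul hv] at h
  rw [h]
  push_cast
  ring_nf

/-- The same against a character of `ℝ/ℤ` at `a x`:
`∫ gaussianPDFReal 0 v x · e^{2πi m a x} dx = e^{-v(2π m a)²/2}`. [folklore] -/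
theorem integral_gaussianPDFReal_mul_fourier {v : ℝ≥0} (hv : v ≠ 0) (m : ℤ) (a : ℝ) :
    ∫ x : ℝ, (gaussianPDFReal 0 v x : ℂ) * fourier m ((a * x : ℝ) : UnitAddCircle) =
      ((Real.exp (-((v : ℝ) * (2 * Real.pi * m * a) ^ 2 / 2)) : ℝ) : ℂ) := by
  have h := integral_gaussianPDFReal_smul_cexp hv (2 * Real.pi * m * a)
  have hpt : ∀ x : ℝ, (gaussianPDFReal 0 v x : ℂ) * fourier m ((a * x : ℝ) : UnitAddCircle) =
      gaussianPDFReal 0 v x • cexp (↑(2 * Real.pi * m * a) * ↑x * I) := by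
    intro x
    rw [fourier_coe_apply, real_smul]
    congr 1
    push_cast
    ring_nf
  simp_rw [hpt, h, ofReal_exp]
  push_cast
  ring_nf

/-- **Block characteristic function**: for the product Gaussian density of variance `2t` on
`ℝ³` and `m ∈ ℤ³`, `∫ ∏ₖ gaussianPDFReal 0 (2t) zₖ · ∏ₖ e^{2πi mₖ a zₖ} dz = e^{-4π²a²t|m|²}`
(transport `EuclideanSpace ℝ (Fin 3) ≃ᵐ (Fin 3 → ℝ)`, Fubini, the one-variable formula).
[folklore] -/
theorem integral_space_gaussian_mul_prod_fourier {t : ℝ≥0} (ht : t ≠ 0) (m : Fin 3 → ℤ) (a : ℝ) :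
    ∫ z : Space, ((∏ k, gaussianPDFReal 0 (2 * t) (z k) : ℝ) : ℂ) *
        ∏ k, fourier (m k) ((a * z k : ℝ) : UnitAddCircle) =
      ((Real.exp (-(4 * Real.pi ^ 2 * a ^ 2 * t * ∑ k, ((m k : ℝ)) ^ 2)) : ℝ) : ℂ) := by
  have hv : (2 : ℝ≥0) * t ≠ 0 := mul_ne_zero two_ne_zero ht
  rw [← (PiLp.volume_preserving_toLp (Fin 3)).integral_comp
    (MeasurableEquiv.toLp 2 _).measurableEmbedding]
  have hpt : ∀ y : Fin 3 → ℝ,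
      ((∏ k, gaussianPDFReal 0 (2 * t) ((WithLp.toLp 2 y : Space) k) : ℝ) : ℂ) *
        ∏ k, fourier (m k) ((a * (WithLp.toLp 2 y : Space) k : ℝ) : UnitAddCircle) =
      ∏ k, (fun (k : Fin 3) (x : ℝ) => (gaussianPDFReal 0 (2 * t) x : ℂ) *
        fourier (m k) ((a * x : ℝ) : UnitAddCircle)) k (y k) := by
    intro y
    simp only [ofReal_prod, ← Finset.prod_mul_distrib]
  simp_rw [hpt]
  rw [volume_pi]
  refine (integral_fintype_prod_eq_prod (𝕜 := ℂ) (μ := fun _ : Fin 3 => (volume : Measure ℝ))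
    (fun (k : Fin 3) (x : ℝ) => (gaussianPDFReal 0 (2 * t) x : ℂ) *
      fourier (m k) ((a * x : ℝ) : UnitAddCircle))).trans ?_
  simp_rw [integral_gaussianPDFReal_mul_fourier hv]
  rw [← ofReal_prod, ← Real.exp_sum]
  congr 2
  rw [Finset.mul_sum, ← Finset.sum_neg_distrib]
  refine Finset.sum_congr rfl fun k _ => ?_
  push_cast
  ring

/-! ### Parseval for `L²` data -/

/-- **Parseval on the cell `[0,L)^{3N}` for `L²` data**: for `Ψ ∈ L²(cell)` (a.e.-strongly
measurable and square integrable on the cell), `∑ₙ ‖ĉₙ(Ψ)‖² = L^{-3N} ∫_cell ‖Ψ‖²`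
(`hasSum_sq_configFourierCoeff` of `PeriodicConfigFourier.lean` is the continuous case; same
transport of Mathlib's `UnitAddTorus.hasSum_sq_mFourierCoeff`, with Mathlib's Haar probability
measure on `ℝ/ℤ` as a term-local instance). [folklore] -/
theorem hasSum_sq_configFourierCoeff_of_memLp (hL : 0 < L) {Ψ : Config N → ℂ}
    (hΨ : MemLp Ψ 2 (volume.restrict (cellN N L))) :
    HasSum (fun n => ‖configFourierCoeff L Ψ n‖ ^ 2)
      (((L ^ 3)⁻¹) ^ N * ∫ X in cellN N L, ‖Ψ X‖ ^ 2) := by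
  -- Mathlib's (local) Haar probability measure on `ℝ/ℤ`, as in `AddCircleMulti`
  letI : MeasureSpace UnitAddCircle := instMeasureSpaceUnitAddCircle
  have hc : ((ENNReal.ofReal L ^ 3)⁻¹) ^ N ≠ ⊤ :=
    ENNReal.pow_ne_top (ENNReal.inv_ne_top.2 (pow_ne_zero _ ((ENNReal.ofReal_pos.2 hL).ne')))
  have hf : MemLp (torusFunN L Ψ) 2 volume := by
    have h1 : MemLp Ψ 2 (Measure.map (fromUnitTorusN (N := N) L) volume) := by
      rw [map_fromUnitTorusN hL]
      exact hΨ.smul_measure hc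
    exact h1.comp_of_map (measurable_fromUnitTorusN L).aemeasurable
  have hP := UnitAddTorus.hasSum_sq_mFourierCoeff (hf.toLp _)
  have hcoef : ∀ n, mFourierCoeff ((hf.toLp _ : UnitAddTorus (Fin N × Fin 3) → ℂ)) n =
      configFourierCoeff L Ψ n := fun n =>
    integral_congr_ae (hf.coeFn_toLp.mono fun t ht => by simp only [ht])
  have hnorm : ∫ t, ‖(hf.toLp _ : UnitAddTorus (Fin N × Fin 3) → ℂ) t‖ ^ 2 =
      ∫ t, ‖torusFunN L Ψ t‖ ^ 2 :=
    integral_congr_ae (hf.coeFn_toLp.mono fun t ht => by simp only [ht])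
  simp only [hcoef, hnorm] at hP
  have htr := integral_fromUnitTorusN hL (G := fun X : Config N => ‖Ψ X‖ ^ 2)
    (hΨ.1.norm.pow 2)
  simp only [smul_eq_mul] at htr
  unfold torusFunN at hP
  rwa [htr] at hP

/-! ### The multiplier of a translation average -/

/-- Joint measurability of `(X, ω) ↦ Ψ(X + φ(ω))`. [folklore] -/
theorem measurable_translate_uncurry {Ψ : Config N → ℂ} (hΨm : Measurable Ψ)
    {Ω : Type*} [MeasurableSpace Ω] {φ : Ω → Config N} (hφ : Measurable φ) :
    Measurable fun p : Config N × Ω => Ψ (p.1 + φ p.2) :=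
  hΨm.comp (measurable_fst.add (hφ.comp measurable_snd))

/-- The translation average `X ↦ ∫ Ψ(X + φ(ω)) dμ(ω)` is strongly measurable. [folklore] -/
theorem stronglyMeasurable_integral_translate {Ψ : Config N → ℂ} (hΨm : Measurable Ψ)
    {Ω : Type*} [MeasurableSpace Ω] (μ : Measure Ω) [SFinite μ] {φ : Ω → Config N}
    (hφ : Measurable φ) :
    StronglyMeasurable fun X : Config N => ∫ ω, Ψ (X + φ ω) ∂μ :=
  (measurable_translate_uncurry hΨm hφ).stronglyMeasurable.integral_prod_right'

/-- For periodic `Ψ ∈ L¹(cell)` and a finite measure `μ`, the kernel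
`(X, ω) ↦ conj(e_n(X)) Ψ(X + φ(ω))` is integrable on `cell × Ω` (Tonelli and the shift invariance
of cell integrals of periodic functions, `lintegral_cellN_comp_add`). [folklore] -/
theorem integrable_cellWaveN_mul_translate (hL : 0 < L) {Ψ : Config N → ℂ} (hΨm : Measurable Ψ)
    (hper : IsTorusPeriodic L Ψ) (hint : ∫⁻ X in cellN N L, ‖Ψ X‖ₑ ≠ ⊤)
    {Ω : Type*} [MeasurableSpace Ω] (μ : Measure Ω) [IsFiniteMeasure μ] {φ : Ω → Config N}
    (hφ : Measurable φ) (n : Fin N × Fin 3 → ℤ) :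
    Integrable (Function.uncurry fun (X : Config N) (ω : Ω) =>
        conj (cellWaveN L n X) * Ψ (X + φ ω)) ((volume.restrict (cellN N L)).prod μ) := by
  have hm : Measurable (Function.uncurry fun (X : Config N) (ω : Ω) =>
      conj (cellWaveN L n X) * Ψ (X + φ ω)) :=
    ((Complex.continuous_conj.comp (continuous_cellWaveN L n)).measurable.comp
      measurable_fst).mul (measurable_translate_uncurry hΨm hφ)
  refine ⟨hm.aestronglyMeasurable, ?_⟩
  unfold HasFiniteIntegral
  rw [lintegral_prod _ hm.enorm.aemeasurable]
  have hpt : ∀ (X : Config N) (ω : Ω), ‖Function.uncurry (fun (X : Config N) (ω : Ω) =>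
      conj (cellWaveN L n X) * Ψ (X + φ ω)) (X, ω)‖ₑ = ‖Ψ (X + φ ω)‖ₑ := by
    intro X ω
    simp only [Function.uncurry_apply_pair, enorm_mul, RCLike.enorm_conj]
    rw [show ‖cellWaveN L n X‖ₑ = 1 from by
      rw [← ofReal_norm, norm_cellWaveN, ENNReal.ofReal_one], one_mul]
  simp_rw [hpt]
  rw [lintegral_lintegral_swap ((hΨm.comp (measurable_fst.add
    (hφ.comp measurable_snd))).enorm.aemeasurable)]
  have hshift : ∀ ω, ∫⁻ X in cellN N L, ‖Ψ (X + φ ω)‖ₑ = ∫⁻ X in cellN N L, ‖Ψ X‖ₑ := fun ω =>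
    lintegral_cellN_comp_add hL (G := fun X => ‖Ψ X‖ₑ) (fun X i k => by rw [hper]) (φ ω)
  simp_rw [hshift]
  rw [lintegral_const]
  exact ENNReal.mul_lt_top hint.lt_top (measure_lt_top _ _)

/-- **Fourier multiplier of a translation average.** For `L > 0`, a measurable `Lℤ³`-periodic
`Ψ ∈ L¹(cell)`, a finite measure `μ` on `Ω` and a measurable `φ : Ω → (ℝ³)^N`,
`ĉₙ(X ↦ ∫ Ψ(X + φ(ω)) dμ(ω)) = (∫ e_n(φ(ω)) dμ(ω)) · ĉₙ(Ψ)` (Fubini and the translation rule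
`configFourierCoeff_translate`). [folklore] -/
theorem configFourierCoeff_integral_translate (hL : 0 < L) {Ψ : Config N → ℂ}
    (hΨm : Measurable Ψ) (hper : IsTorusPeriodic L Ψ) (hint : ∫⁻ X in cellN N L, ‖Ψ X‖ₑ ≠ ⊤)
    {Ω : Type*} [MeasurableSpace Ω] (μ : Measure Ω) [IsFiniteMeasure μ] {φ : Ω → Config N}
    (hφ : Measurable φ) (n : Fin N × Fin 3 → ℤ) :
    configFourierCoeff L (fun X => ∫ ω, Ψ (X + φ ω) ∂μ) n =
      (∫ ω, mFourier n (toUnitTorusN L (φ ω)) ∂μ) * configFourierCoeff L Ψ n := by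
  rw [configFourierCoeff_eq_integral hL
    ((stronglyMeasurable_integral_translate hΨm μ hφ).aestronglyMeasurable) n]
  have h1 : ∀ X : Config N, conj (cellWaveN L n X) * ∫ ω, Ψ (X + φ ω) ∂μ =
      ∫ ω, conj (cellWaveN L n X) * Ψ (X + φ ω) ∂μ := fun X => (integral_const_mul _ _).symm
  simp_rw [h1]
  rw [integral_integral_swap (integrable_cellWaveN_mul_translate hL hΨm hper hint μ hφ n)]
  rw [← integral_smul]
  have h2 : ∀ ω : Ω, ((((L ^ 3)⁻¹) ^ N : ℝ)) • ∫ X in cellN N L, conj (cellWaveN L n X) * Ψ (X + φ ω)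
      = mFourier n (toUnitTorusN L (φ ω)) * configFourierCoeff L Ψ n := by
    intro ω
    have hm' : Measurable (fun X : Config N => Ψ (X + φ ω)) :=
      hΨm.comp (measurable_id.add_const (φ ω))
    rw [← configFourierCoeff_eq_integral hL hm'.aestronglyMeasurable n]
    exact configFourierCoeff_translate hL hper (φ ω) n
  simp_rw [h2]
  exact integral_mul_const _ _

/-! ### The free torus flow as a Gaussian translation average -/

/-- Without interaction (`v = 0`) the periodic Feynman–Kac weight is `1`. [folklore] -/
theorem periodicFKWeight_zero_pot (L T : ℝ) (X : Config N) (ω : PathSpace N) :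
    periodicFKWeight 0 L T X ω = 1 := by
  have h : periodicPathAction (0 : ℝ → ℝ≥0∞) L T X ω = 0 := by
    simp [periodicPathAction, periodicInteraction, periodizedPotential]
  simp [periodicFKWeight, h]

/-- **The free periodic flow is the Gaussian translation average**
`(e^{tΔ}ψ)(X) = E[ψ(X + √2 b_t)]` (`periodicHeatFlow` at `v = 0`). [folklore] -/
theorem periodicHeatFlow_zero_pot_apply (L t : ℝ) (ψ : Config N → ℂ) (X : Config N) :
    periodicHeatFlow 0 N L t ψ X =
      ∫ ω, ψ (X + displacement t.toNNReal ω) ∂wienerPaths N := by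
  rw [periodicHeatFlow_eq]
  refine integral_congr_ae (Eventually.of_forall fun ω => ?_)
  simp only [periodicFKWeight_zero_pot, ENNReal.toReal_one, one_smul, worldLine_eq_add_displacement]

/-- The plane wave as a product over particles and axes,
`e_n(Y) = ∏ᵢ ∏ₖ e^{2πi n_{ik} Y_{ik}/L}`. [folklore] -/
theorem mFourier_toUnitTorusN (L : ℝ) (n : Fin N × Fin 3 → ℤ) (Y : Config N) :
    mFourier n (toUnitTorusN L Y) = ∏ i, ∏ k, fourier (n (i, k)) ((L⁻¹ * Y i k : ℝ) : UnitAddCircle) := by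
  simp only [mFourier, ContinuousMap.coe_mk, toUnitTorusN_apply]
  rw [Fintype.prod_prod_type]
  refine Finset.prod_congr rfl fun i _ => Finset.prod_congr rfl fun k _ => ?_
  rw [div_eq_inv_mul]

/-- **Characteristic function of the displacement**: `E[e_n(√2 b_t)] = e^{-4π²t|n|²/L²}` for
`t > 0` (the law `N(0, 2t I_{3N})` of the displacement, `map_displacement`, Fubini over the
particles and the block formula). [folklore] -/
theorem integral_wienerPaths_mFourier_displacement (L : ℝ) {t : ℝ≥0} (ht : t ≠ 0)
    (n : Fin N × Fin 3 → ℤ) :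
    ∫ ω, mFourier n (toUnitTorusN L (displacement t ω)) ∂wienerPaths N =
      ((Real.exp (-(4 * Real.pi ^ 2 * (L⁻¹) ^ 2 * t * ∑ p, ((n p : ℝ)) ^ 2)) : ℝ) : ℂ) := by
  have hcont : Continuous fun Y : Config N => mFourier n (toUnitTorusN L Y) :=
    continuous_cellWaveN L n
  rw [← integral_map (measurable_displacement t).aemeasurable hcont.aestronglyMeasurable,
    map_displacement_eq ht]
  rw [integral_withDensity_eq_integral_toReal_smul (measurable_gaussDensity (2 * t))
    (Eventually.of_forall fun Y =>
    ENNReal.prod_lt_top fun i _ => ENNReal.prod_lt_top fun k _ => gaussianPDF_lt_top)]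
  have hpt : ∀ Y : Config N, (∏ i, ∏ k, gaussianPDF 0 (2 * t) (Y i k)).toReal •
      mFourier n (toUnitTorusN L Y) =
      ∏ i, (fun (i : Fin N) (z : Space) => ((∏ k, gaussianPDFReal 0 (2 * t) (z k) : ℝ) : ℂ) *
        ∏ k, fourier (n (i, k)) ((L⁻¹ * z k : ℝ) : UnitAddCircle)) i (Y i) := by
    intro Y
    rw [mFourier_toUnitTorusN, ENNReal.toReal_prod, real_smul, ofReal_prod, ← Finset.prod_mul_distrib]
    refine Finset.prod_congr rfl fun i _ => ?_
    congr 2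
    rw [ENNReal.toReal_prod]
    exact Finset.prod_congr rfl fun k _ => ENNReal.toReal_ofReal (gaussianPDFReal_nonneg _ _ _)
  simp_rw [hpt]
  rw [volume_pi]
  refine (integral_fintype_prod_eq_prod (𝕜 := ℂ) (μ := fun _ : Fin N => (volume : Measure Space))
    (fun (i : Fin N) (z : Space) => ((∏ k, gaussianPDFReal 0 (2 * t) (z k) : ℝ) : ℂ) *
        ∏ k, fourier (n (i, k)) ((L⁻¹ * z k : ℝ) : UnitAddCircle))).trans ?_
  simp_rw [integral_space_gaussian_mul_prod_fourier ht]
  rw [← ofReal_prod, ← Real.exp_sum]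
  congr 2
  rw [Finset.mul_sum, ← Finset.sum_neg_distrib, Fintype.sum_prod_type]
  exact Finset.sum_congr rfl fun i _ => by rw [Finset.mul_sum, ← Finset.sum_neg_distrib]

/-- **Fourier multiplier of the free torus flow**: for `L > 0`, `t > 0` and a measurable periodic
`Ψ ∈ L¹(cell)`, `ĉₙ(e^{tΔ}Ψ) = e^{-4π²t|n|²/L²} ĉₙ(Ψ)`. [folklore] -/
theorem configFourierCoeff_periodicHeatFlow_zero_pot (hL : 0 < L) {Ψ : Config N → ℂ}
    (hΨm : Measurable Ψ) (hper : IsTorusPeriodic L Ψ) (hint : ∫⁻ X in cellN N L, ‖Ψ X‖ₑ ≠ ⊤)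
    {t : ℝ} (ht : 0 < t) (n : Fin N × Fin 3 → ℤ) :
    configFourierCoeff L (periodicHeatFlow 0 N L t Ψ) n =
      ((Real.exp (-(4 * Real.pi ^ 2 * (L⁻¹) ^ 2 * t * ∑ p, ((n p : ℝ)) ^ 2)) : ℝ) : ℂ) *
        configFourierCoeff L Ψ n := by
  have ht' : t.toNNReal ≠ 0 := by simpa using ht
  have h1 : periodicHeatFlow 0 N L t Ψ = fun X => ∫ ω, Ψ (X + displacement t.toNNReal ω)
      ∂wienerPaths N :=
    funext (periodicHeatFlow_zero_pot_apply L t Ψ)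
  rw [h1, configFourierCoeff_integral_translate hL hΨm hper hint (wienerPaths N)
    (measurable_displacement t.toNNReal) n, integral_wienerPaths_mFourier_displacement L ht' n,
    Real.coe_toNNReal t ht.le]

/-! ### The tagged-particle smoothing as a Gaussian translation average -/

/-- The plane wave at a translation of the tagged block only:
`e_n(-z e₀) = ∏ₖ e^{-2πi n_{0k} z_k/L}`. [folklore] -/
theorem mFourier_toUnitTorusN_single_zero (L : ℝ) (n : Fin (N + 1) × Fin 3 → ℤ) (z : Space) :
    mFourier n (toUnitTorusN L (Pi.single (0 : Fin (N + 1)) (-z) : Config (N + 1))) =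
      ∏ k, fourier (n (0, k)) (((-L⁻¹) * z k : ℝ) : UnitAddCircle) := by
  rw [mFourier_toUnitTorusN, Fintype.prod_eq_single (0 : Fin (N + 1))]
  · refine Finset.prod_congr rfl fun k _ => ?_
    simp only [Pi.single_eq_same, PiLp.neg_apply]
    congr 2
    ring
  · intro i hi
    simp [Pi.single_eq_of_ne hi]

/-- The product Gaussian density of variance `2T` on `ℝ³` defines a probability measure (it is
the law of `√2 b_T`, `map_toLp_sqrt_two_mul_brownian`). [folklore] -/
theorem isProbabilityMeasure_withDensity_gaussian {T : ℝ≥0} (hT : T ≠ 0) :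
    IsProbabilityMeasure ((volume : Measure Space).withDensity
      fun z : Space => ∏ k, gaussianPDF 0 (2 * T) (z k)) := by
  haveI := Literature.Probability.RandomPlanarGeometry.isProbabilityMeasure_preWienerMeasure'
  rw [← map_toLp_sqrt_two_mul_brownian hT]
  refine Measure.isProbabilityMeasure_map ?_
  exact ((WithLp.measurable_toLp 2 _).comp (measurable_pi_lambda _ fun k =>
    ((measurable_brownian T).const_mul _).comp (measurable_pi_apply k))).aemeasurable

/-- The block Gaussian density is measurable. [folklore] -/
theorem measurable_gaussian_block (T : ℝ≥0) :
    Measurable fun z : Space => ∏ k, gaussianPDF 0 (2 * T) (z k) :=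
  Finset.measurable_prod _ fun k _ => (measurable_gaussianPDF _ _).comp
    ((measurable_pi_apply k).comp (WithLp.measurable_ofLp 2 _))

/-- Integration against the block Gaussian law is integration against its real density.
[folklore] -/
theorem integral_withDensity_gaussian (T : ℝ≥0) (F : Space → ℂ) :
    ∫ z, F z ∂(volume : Measure Space).withDensity (fun z : Space => ∏ k, gaussianPDF 0 (2 * T) (z k)) =
      ∫ z : Space, ((∏ k, gaussianPDFReal 0 (2 * T) (z k) : ℝ) : ℂ) * F z := by
  rw [integral_withDensity_eq_integral_toReal_smul (measurable_gaussian_block T)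
    (Eventually.of_forall fun z => ENNReal.prod_lt_top fun k _ => gaussianPDF_lt_top)]
  refine integral_congr_ae (Eventually.of_forall fun z => ?_)
  dsimp only
  rw [real_smul, ENNReal.toReal_prod, ofReal_prod, ofReal_prod]
  congr 1
  exact Finset.prod_congr rfl fun k _ => by
    rw [gaussianPDF, ENNReal.toReal_ofReal (gaussianPDFReal_nonneg _ _ _)]

/-- The embedding `z ↦ (-z) e₀` of the tagged block is measurable. [folklore] -/
theorem measurable_single_zero_neg :
    Measurable fun z : Space => (Pi.single (0 : Fin (N + 1)) (-z) : Config (N + 1)) := by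
  have hφ0 : Measurable fun w : Space => (Pi.single (0 : Fin (N + 1)) w : Config (N + 1)) :=
    measurable_pi_iff.2 fun i => by
      rcases eq_or_ne i 0 with rfl | hi
      · simp only [Pi.single_eq_same]; exact measurable_id
      · simp only [Pi.single_eq_of_ne hi]; exact measurable_const
  exact hφ0.comp measurable_neg

/-- **Fourier multiplier of the tagged-particle smoothing**: for `L > 0`, `T > 0` and a
measurable periodic `Ψ ∈ L¹(cell)` of `N + 1` particles, the Gaussian average of translates in
the tagged block `0`, `X ↦ ∫ Ψ(X - z e₀) dγ_{2T}(z)`, has coefficients `e^{-4π²T|n₀|²/L²} ĉₙ(Ψ)`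
(`n₀ = n(0, ·)` the tagged block of the frequency). [folklore] -/
theorem configFourierCoeff_gaussian_single_zero {N : ℕ} {L : ℝ} (hL : 0 < L) {Ψ : Config (N + 1) → ℂ}
    (hΨm : Measurable Ψ) (hper : IsTorusPeriodic L Ψ)
    (hint : ∫⁻ X in cellN (N + 1) L, ‖Ψ X‖ₑ ≠ ⊤) {T : ℝ≥0} (hT : T ≠ 0)
    (n : Fin (N + 1) × Fin 3 → ℤ) :
    configFourierCoeff L (fun X => ∫ z, Ψ (X + Pi.single (0 : Fin (N + 1)) (-z))
      ∂(volume : Measure Space).withDensity (fun z : Space => ∏ k, gaussianPDF 0 (2 * T) (z k))) n =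
      ((Real.exp (-(4 * Real.pi ^ 2 * (L⁻¹) ^ 2 * T * ∑ k, ((n (0, k) : ℝ)) ^ 2)) : ℝ) : ℂ) *
        configFourierCoeff L Ψ n := by
  haveI := isProbabilityMeasure_withDensity_gaussian hT
  rw [configFourierCoeff_integral_translate hL hΨm hper hint _ measurable_single_zero_neg n,
    integral_withDensity_gaussian]
  simp_rw [mFourier_toUnitTorusN_single_zero]
  rw [integral_space_gaussian_mul_prod_fourier hT]
  congr 3
  ring

end Summit.AtomisticToContinuum.BoseEinsteinCondensation.Theorems.CorrectorClosure.HealingScaleKacInsertion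

end
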